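import Literature.MathematicalPhysics.QuantumFieldTheory.Balaban1983to89.B9CubeDirInverseBondCLocalityAtRecordY
import Literature.MathematicalPhysics.QuantumFieldTheory.Balaban1983to89.B9WalkLettersOps

/-!
# `Balaban1983to89.B9BondReadDomainsPinY` — [Balaban1985BackgroundPropagators] p. 410 l. 14–15 («the operators G′_□(U), … depend on U restricted to Ω₀(□) ⊂ □̃⁵»):
# THE MINIMAL READING DOMAINS OF THE N06 HEADS' CUBE LETTERS, NAMED — the site reading domain `nearPinY x □ := nearDomY x □ ∪ Ω₀(□)` and the bond reading domain
# `nearAPinCY i □ Ω₀(□) := bondReadSetY i □ Ω₀(□) ∪ knitSrcSetCY i □ Ω₀(□)` (the sources of the cube sequence's knit dependency sets meeting `Ω₀(□)`), with the four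
# inclusion rows of the heads («KE₁₈X-C»: `hnear hSnear hRnearA hDnearCA`) as theorems BY CONSTRUCTION

T. Bałaban, *Propagators for lattice gauge theories in a background field*, Commun. Math. Phys. **99** (1985) 389–434 [Balaban1985BackgroundPropagators] = [B9]: p. 410 l. 14–15,
p. 413 («it depends on U restricted to X̃⁵»), (3.12)–(3.14) p. 393 («Q … is a local operator»), p. 394 l. 30–33, (3.88) p. 409; T. Bałaban, *Averaging operations for lattice gauge
theories*, Commun. Math. Phys. **98** (1985) 17–51 [Balaban1985Averaging]: p. 24 (the double block `B^j(c₋) ∪ B^j(c₊)`).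

WHY THIS FILE (seat dag-n06-d g34, INTENT-7).  The N06 heads carry two free reading-domain data `near x □`, `nearA x □ : Finset (SiteY x.toKIdx)` constrained ONLY by inclusion
rows: `hnear : nearDomY x □ ⊆ near x □` (the site letters' one-step thickening of `□̃`), `hSnear : Ω₀(□) ⊆ near x □`, `hRnearA : bondReadSetY x □ Ω₀(□) ⊆ nearA x □`,
`hDnearCA : (a cube-knit dependency set meeting Ω₀(□)) ⊆ nearA x □ (sources)`.  No size or count row reads them (the N24 junction consumes `∃ Y₀, B9LeafX Y₀`).  This file names
the MINIMAL admissible domains, so the heads can pin `near := nearPinY`, `nearA := nearAPinCY … Ω₀(□)` and PROVE the four rows — print's «Ω₀(□) ⊂ □̃⁵» is then the ONE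
geometric statement `nearAPinCY ⊆ □̃⁵` left for whoever needs a size bound, not four hypotheses.
* §1 (index level) `knitSrcSetCY i □ S`, `mem_knitSrcSetCY`, ★ `nearAPinCY i □ S`, `bondReadSetY_subset_nearAPinCY`, ★ `knitDep_src_mem_nearAPinCY` (= `hDnearCA`'s shape), and the
  agreement lemma `GDirCKY_congr_of_agree310WalkYO_pin` (✓`GDirCKY_congr_of_agree310WalkYO` with both inclusions discharged at the pin);
* §2 (member level) ★ `nearPinY x □`, `nearDomY_subset_nearPinY` (= `hnear`), `dirDomY_subset_nearPinY` (= `hSnear`).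

HONEST SCOPE.  Bookkeeping definitions with bodies (three `Finset`-valued `def`s) and inclusion lemmas; no estimate, no size bound (`⊆ □̃⁵` is NOT claimed).  Count-neutral
(`--supports stmt-QuantumFields-27239`); N06 NOT discharged; nothing continuum ∕ OS ∕ mass gap ∕ Clay — the Yang–Mills mass gap is NOT proved by any of this.  NEW file; nothing
landed is modified; no `sorry`, no `axiom`, no `instance`, no `notation`.  Net new unproved facts: 0.
-/

noncomputable section

namespace Literature.MathematicalPhysics.QuantumFieldTheory.Balaban1983to89.B9BondReadDomainsPinY

open B6KLevelCensusIndexV1 (KIdx)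
open B6Cover236MultiLevelBlocks (cubes)
open B9CubeLettersBondOpsL0 (IBondCubeY)
open B9PinMembersKLevelV1 (MemberY)
open B9Eq3115KnitCubeLetterY (knitDepP GDirCKY)
open B9CubeDirInverseBondLocalityAtRecordY (bondReadSetY)
open B9CubeDirInverseBondCLocalityAtRecordY (GDirCKY_congr_of_agree310WalkYO)
open B9WalkLettersOps (nearDomY)
open B9WalkLettersOps310 (agree310WalkYO)
open Node00
open Node00.OpsYNablaBridge (chartY)
open Node00.OpsYCubeProjectionG (DPDsDirCubeY)
open Node00.OpsYCubeDirInverseBond (bondsOverY)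
open scoped Matrix Matrix.Norms.L2Operator

variable {d ℓ : ℕ} {hd : 1 ≤ d + 1} {hL : Odd (ℓ + 1) ∧ 1 < ℓ + 1} {b₀ b₁ : ℝ}

/-! ## §1 The bond reading domain of the (C) letter over a site set `S` -/

section Index

variable (i : KIdx d ℓ hd hL b₀ b₁) (q : ↥(cubes (toKT i).D.toDomains)) (S : Finset (SiteY i))

open Classical in
/-- **THE SOURCES OF THE CUBE SEQUENCE's KNIT DEPENDENCY SETS MEETING `S`**: the sites `b′₋` of the bonds `b′ ∈ knitDepP i ι.1` (the double block `B^n(ι₋) ∪ B^n(ι₊)`), over the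
index bonds `ι` of `{Ω_n(□)}` whose dependency set has a bond issuing from `S` — what the averaging term `Q*_□(U)a_□Q_□(U)` of `G_□(U)` reads beyond `S`.
[cite: Balaban1985BackgroundPropagators, (3.12)–(3.14) p.393, p.410 L14–15; Balaban1985Averaging, p.24] -/
def knitSrcSetCY : Finset (SiteY i) :=
  Finset.univ.filter fun z => ∃ ι : IBondCubeY i q, (∃ b ∈ knitDepP i ι.1, chartY i b.src ∈ S) ∧ ∃ b' ∈ knitDepP i ι.1, chartY i b'.src = z

variable {i q S}

/-- membership: a source of a dependency set meeting `S`. [cite: Balaban1985Averaging, p.24, bookkeeping] -/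
theorem mem_knitSrcSetCY (ι : IBondCubeY i q) (hι : ∃ b ∈ knitDepP i ι.1, chartY i b.src ∈ S) {b' : FBondY i} (hb' : b' ∈ knitDepP i ι.1) :
    chartY i b'.src ∈ knitSrcSetCY i q S := by
  classical
  unfold knitSrcSetCY
  simp only [Finset.mem_filter, Finset.mem_univ, true_and]
  exact ⟨ι, hι, b', hb', rfl⟩

variable (i q S)

/-- ★ **THE BOND READING DOMAIN OF `G_□(U)` OVER `S = Ω₀(□)`, MINIMAL**: the reading set of the local letters (sites of `S`, their `± e_κ`, `− e_κ + e_κ′` translates, the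
`𝔅_□`-block hull — ✓`bondReadSetY`) together with the sources of the cube-knit dependency sets meeting `S`.  Print: it lies in `□̃⁵` (NOT claimed here).
[cite: Balaban1985BackgroundPropagators, p.410 L14–15 («Ω₀(□) ⊂ □̃⁵»), p.413, (3.10) p.392, p.394 L30–33] -/
def nearAPinCY : Finset (SiteY i) := bondReadSetY i q S ∪ knitSrcSetCY i q S

variable {i q S}

/-- the reading set lies in the pinned domain (the heads' row `hRnearA`, by construction). [cite: Balaban1985BackgroundPropagators, p.410 L14–15, bookkeeping] -/
theorem bondReadSetY_subset_nearAPinCY : bondReadSetY i q S ⊆ nearAPinCY i q S :=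
  Finset.subset_union_left

/-- ★ a cube-knit dependency set meeting `S` has its sources in the pinned domain (the heads' row `hDnearCA`, by construction).
[cite: Balaban1985BackgroundPropagators, (3.12)–(3.14) p.393, p.410 L14–15; Balaban1985Averaging, p.24] -/
theorem knitDep_src_mem_nearAPinCY (ι : IBondCubeY i q) (hι : ∃ b ∈ knitDepP i ι.1, chartY i b.src ∈ S) :
    ∀ b' ∈ knitDepP i ι.1, chartY i b'.src ∈ nearAPinCY i q S := fun _ hb' =>
  Finset.mem_union_right _ (mem_knitSrcSetCY ι hι hb')

end Index

/-! ## §2 The site reading domain of the (β) site letter, and the member-level agreement lemma at the pins -/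

section Member

variable {Mstar : ℕ} (x : MemberY d ℓ hd hL b₀ b₁ Mstar) (c : ↥(cubes x.toKIdx.D.toDomains))

/-- ★ **THE SITE READING DOMAIN OF `G′_□(U)`, MINIMAL**: the one-step thickening `nearDomY x □` of `□̃` together with the Dirichlet domain `Ω₀(□)` (the heads' rows `hnear`,
`hSnear` by construction). [cite: Balaban1985BackgroundPropagators, p.410 L14–15, (3.3) p.390, p.394] -/
def nearPinY : Finset (SiteY x.toKIdx) := nearDomY x c ∪ B9Cor35GpDirInputsAtOne.dirDomY x.toKIdx c

/-- `nearDomY x □ ⊆ nearPinY x □` (the row `hnear`). [cite: Balaban1985BackgroundPropagators, p.410 L14–15, bookkeeping] -/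
theorem nearDomY_subset_nearPinY : nearDomY x c ⊆ nearPinY x c := Finset.subset_union_left

/-- `Ω₀(□) ⊆ nearPinY x □` (the row `hSnear`). [cite: Balaban1985BackgroundPropagators, p.394, p.410 L14–15, bookkeeping] -/
theorem dirDomY_subset_nearPinY : B9Cor35GpDirInputsAtOne.dirDomY x.toKIdx c ⊆ nearPinY x c := Finset.subset_union_right

end Member

section MemberKnit

variable {N : ℕ} [Nonempty (Fin N)] {Mstar : ℕ} (x : MemberY d ℓ hd hL b₀ b₁ Mstar) (B : B9.Backgrounds)
  (cfg : B.Cfg → CfgY (Matrix (Fin N) (Fin N) ℂ) x.toKIdx) (c : ↥(cubes x.toKIdx.D.toDomains))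

/-- ★★ **THE `hOagrA` ROW AT THE PINNED BOND READING DOMAIN**: with `nearA x □ := nearAPinCY x.toKIdx □ S`, the walk reading's agreement predicate gives `G_□(U) = G_□(U′)` for the
(C) letter of record with NO inclusion hypothesis left (✓`GDirCKY_congr_of_agree310WalkYO` at the two inclusions by construction).
[cite: Balaban1985BackgroundPropagators, p.410 L14–15 («depend on U restricted to Ω₀(□) ⊂ □̃⁵»), p.413, p.409 l.3–5] -/
theorem GDirCKY_congr_of_agree310WalkYO_pin (S : Finset (SiteY x.toKIdx)) (near : ↥(cubes x.toKIdx.D.toDomains) → Finset (SiteY x.toKIdx))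
    (hpin : near c = nearAPinCY x.toKIdx c S) {U U' : B.Cfg} (h : agree310WalkYO x B cfg near c U U') :
    GDirCKY x.toKIdx c (DPDsDirCubeY x.toKIdx c S) (bondsOverY x.toKIdx S) (cfg U) = GDirCKY x.toKIdx c (DPDsDirCubeY x.toKIdx c S) (bondsOverY x.toKIdx S) (cfg U') :=
  GDirCKY_congr_of_agree310WalkYO x B cfg c near S (hpin ▸ bondReadSetY_subset_nearAPinCY) (fun ι hι b' hb' => hpin ▸ knitDep_src_mem_nearAPinCY ι hι b' hb') h

end MemberKnit

end Literature.MathematicalPhysics.QuantumFieldTheory.Balaban1983to89.B9BondReadDomainsPinY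

end
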